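import Mathlib
import HarnessLib
import Summits.Langlands.Langlands.Theses.SenNullAlignment
import Summits.Langlands.Langlands.Theorems.IrreducibilityBySelfDualityReciprocityUpToIrreducibilityCorrespondsConj
import Literature.NumberTheory.PAdicHodge.SenOperator

/-!
# Position of the crux `SingularProjectiveFinite` (stmt-Langlands-16358) relative to the summit
# — redirect strategist r1, route `route-Langlands-SenNullAlignment`

Kernel-checked content (no `sorry`):

* `hodgeTateAtPlace_of_langlands` — **the OPEN HEART of the crux is a CONSEQUENCE of the summit**
  modulo ONE printed theorem of `p`-adic Hodge theory: `Langlands → DeRhamIsHodgeTate → SenOperatorExistsUnique →` (under the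
  crux hypotheses, at EVERY `v ∣ ℓ`, `ρ|_{Γ_{K_v}}` is Hodge–Tate at every `τ`).  Here
  `DeRhamIsHodgeTate` (Fontaine: `B_dR`-admissible ⇒ Hodge–Tate ⇒ Sen's `Θ_τ` semisimple with
  integer eigenvalues) is stated over the tree's carriers (Fontaine's PINNED datum
  `fontainePstAdicCompletion v ℓ hv` = `RD.pst ℓ v hv` by definition, and the Sen carrier
  `FramedGaloisRep.IsHodgeTateAt` of `Literature/NumberTheory/PAdicHodge/SenOperator`).  The proof
  takes `RD` from the summit's non-vacuity conjunct, the avatar `ρ_π` from direction (A) at `n = 2`,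
  identifies the crux's `ρ` with `ρ_π` up to conjugacy by the LANDED Chebotarev + Brauer–Nesbitt
  theorem `ReciprocityUpToIrreducibility.isConjugate_of_satakeFrobCompatibleAt`, transports
  geometricity along the conjugacy (`isGeometricFramed_of_isConjugate`, landed) and applies the fact.
  The crux's arithmetic hypotheses (totally real, holomorphic of weight `(k, w)`, totally odd, some
  `k_β = 1`, `v` aligned) are NOT used: the summit gives Hodge–Tate-ness everywhere.
* `singularProjectiveFinite_of_langlands` — **`S` + printed theorems ⇒ `C`**:
  `Langlands → DeRhamIsHodgeTate → SenOperatorExistsUnique → SenFiniteness → S₁ → S₃ →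
  SingularProjectiveFinite`, where `S₁` (single Sen weight at aligned places: Boxer–Pilloni 2021
  Thm. 23 (3), arXiv:2110.10251 p. 10) and `S₃` (projective Sen finiteness + the inertia dictionary:
  Sen 1973) are VERBATIM the registered stubs `stub_senWeightsCoincideAtAligned`,
  `stub_projectiveSenFiniteness` of the crux's line `Lines/birth.lean`, and the two Sen facts are the
  tree's named facts.  So the only stub of `birth` that is NOT in print — `stub_hodgeTateAtAligned` —
  is implied by the summit: `C ≤ S` modulo theorems in print, i.e. the crux is a CONSEQUENCE of `S`.
* The other direction is recorded by the probe files `bc/SPF_probe_CtoS*.lean` (all FAIL): no cheap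
  `C → S`; informally `C` says nothing about local–global compatibility, direction (B), `n ≠ 2`,
  non-totally-real `K`, or non-aligned places.  Hence `C` is STRICTLY WEAKER than `S` (on paper),
  not the summit in costume.

The interface definitions `SenSingleWeightAt`, `HodgeTateAtPlace`, `ProjFiniteInertiaAt`,
`UnderCruxHypotheses` are COPIED verbatim from `Cruxes/SingularProjectiveFinite/Lines/birth.lean`
(namespace `…Birth`) so that this file does not import a sorried skeleton; `crux_iff` re-certifies
that the telescope is the crux's, by `Iff.rfl`.
-/

noncomputable section

set_option linter.dupNamespace false

namespace Summit.Langlands.Langlands.Cruxes.SingularProjectiveFinite.PositionR1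

open scoped BigOperators Topology Classical Matrix NumberField
open Filter Set Function IsDedekindDomain NumberField Field
open Literature.NumberTheory.GaloisRepresentations Literature.NumberTheory.Automorphic
open Literature.NumberTheory.PAdicHodge (SenOperatorExistsUnique SenFiniteness)
open Summit.Langlands
open Summit.Langlands.Langlands.Theses.SenNullAlignment (SingularProjectiveFinite)
open Summit.Langlands.Langlands.Theorems.ReciprocityUpToIrreducibility
  (isConjugate_of_satakeFrobCompatibleAt isGeometricFramed_of_isConjugate)

/-! ## Interfaces (verbatim copies of `Lines/birth.lean`) -/

section Interfaces

variable {K : Type} [Field K] [NumberField K] {ℓ : ℕ} [Fact ℓ.Prime]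

/-- Single Sen weight at `v` (copy of `Birth.SenSingleWeightAt`). -/
def SenSingleWeightAt (ρ : FramedGaloisRep K (PadicAlgCl ℓ) 2) (v : HeightOneSpectrum (𝓞 K))
    (hv : ((ℓ : ℕ) : 𝓞 K) ∈ v.asIdeal) : Prop :=
  ∃ m : ℤ, ∀ τ : v.adicCompletion K →+* PadicAlgCl ℓ,
    ρ.senWeightsAt v (LocalField.adicCompletionPadicAlgebra v ℓ hv) τ ⊆ {(m : PadicAlgCl ℓ)}

/-- Hodge–Tate at the place `v`, every `τ` (copy of `Birth.HodgeTateAtPlace`). -/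
def HodgeTateAtPlace (ρ : FramedGaloisRep K (PadicAlgCl ℓ) 2) (v : HeightOneSpectrum (𝓞 K))
    (hv : ((ℓ : ℕ) : 𝓞 K) ∈ v.asIdeal) : Prop :=
  ∀ τ : v.adicCompletion K →+* PadicAlgCl ℓ,
    ρ.IsHodgeTateAt v (LocalField.adicCompletionPadicAlgebra v ℓ hv) τ

/-- Inertia finite modulo scalars above `v` — the crux's conclusion verbatim (copy of
`Birth.ProjFiniteInertiaAt`). -/
def ProjFiniteInertiaAt (ρ : FramedGaloisRep K (PadicAlgCl ℓ) 2) (v : HeightOneSpectrum (𝓞 K)) :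
    Prop :=
  ∀ 𝔓 ∈ v.primesAbove, ∃ S : Finset (GL (Fin 2) (PadicAlgCl ℓ)), ∀ σ ∈ 𝔓.inertia (Field.absoluteGaloisGroup K), ∃ g ∈ S, ∃ c : PadicAlgCl ℓ, ((ρ σ : GL (Fin 2) (PadicAlgCl ℓ)) : Matrix (Fin 2) (Fin 2) (PadicAlgCl ℓ)) = c • ((g : GL (Fin 2) (PadicAlgCl ℓ)) : Matrix (Fin 2) (Fin 2) (PadicAlgCl ℓ))

end Interfaces

/-- The crux's binder telescope with a variable conclusion (copy of `Birth.UnderCruxHypotheses`). -/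
def UnderCruxHypotheses
    (C : ∀ (K : Type) [Field K] [NumberField K] (ℓ : ℕ) [Fact ℓ.Prime],
      Literature.NumberTheory.GaloisRepresentations.FramedGaloisRep K (PadicAlgCl ℓ) 2 →
        ∀ v : IsDedekindDomain.HeightOneSpectrum (NumberField.RingOfIntegers K),
          ((ℓ : ℕ) : NumberField.RingOfIntegers K) ∈ v.asIdeal → Prop) : Prop :=
  ∀ (K : Type) [Field K] [NumberField K], NumberField.IsTotallyReal K → ∀ (hcpt : Literature.NumberTheory.Automorphic.isCompact_glFiniteIntegralLevel 2 K) (π : Literature.NumberTheory.Automorphic.CuspidalAutomorphicRepData 2 K hcpt) (k : (K →+* ℂ) → ℕ) (w : ℤ), π.1.IsLAlgebraic → π.1.HasInfinityType (fun β : K →+* ℂ => ({(⟨((k β : ℂ) - 1 - w) / 2, (1 - (k β : ℂ) - w) / 2, (k β : ℤ) - 1, by push_cast; ring⟩ : Literature.NumberTheory.Automorphic.ArchWeight), (⟨((k β : ℂ) - 1 - w) / 2, (1 - (k β : ℂ) - w) / 2, (k β : ℤ) - 1, by push_cast; ring⟩ : Literature.NumberTheory.Automorphic.ArchWeight).swap}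 : Multiset Literature.NumberTheory.Automorphic.ArchWeight)) → (∀ (u : NumberField.InfinitePlace K), ∀ φ ∈ π.1.W, Literature.NumberTheory.Automorphic.rightTranslation (Literature.NumberTheory.Automorphic.AdelicGroupData.gl 2 K) (Matrix.GeneralLinearGroup.scalar (Fin 2) (Units.map (MonoidHom.inl (NumberField.InfiniteAdeleRing K) (IsDedekindDomain.FiniteAdeleRing (NumberField.RingOfIntegers K) K) : NumberField.InfiniteAdeleRing K →* NumberField.AdeleRing (NumberField.RingOfIntegers K) K) (Units.map (MonoidHom.mulSingle (fun u' : NumberField.InfinitePlace K => u'.Completion) u : u.Completion →* NumberField.InfiniteAdeleRing K) (-1)))) φ + φ ∈ π.1.W') → (∃ β : K →+* ℂ, k β = 1) → ∀ (ℓ : ℕ) [Fact ℓ.Prime] (ι : PadicAlgCl ℓ ≃+* ℂ) (ρ : Literature.NumberTheory.GaloisRepresentations.FramedGaloisRep K (PadicAlgCl ℓ) 2), ρ.toGaloisRep.IsIrreducible → (∀ᶠ v : IsDedekindDomain.HeightOneSpectrum (NumberField.RingOfIntegers K) in Filter.cofinite, Summit.Langlands.SatakeFrobCompatibleAt ι π.1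 ρ v) → ∀ (v : IsDedekindDomain.HeightOneSpectrum (NumberField.RingOfIntegers K)) (hv : ((ℓ : ℕ) : NumberField.RingOfIntegers K) ∈ v.asIdeal), (∀ τ : K →+* PadicAlgCl ℓ, (∀ x : NumberField.RingOfIntegers K, x ∈ v.asIdeal → ‖τ x‖ < 1) → k ((ι : PadicAlgCl ℓ →+* ℂ).comp τ) = 1) → C K ℓ ρ v hv

/-- Read-back: the crux is LITERALLY the telescope with conclusion `ProjFiniteInertiaAt ρ v`. -/
theorem crux_iff :
    SingularProjectiveFinite ↔ UnderCruxHypotheses fun _ _ _ _ _ ρ v _ => ProjFiniteInertiaAt ρ v :=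
  Iff.rfl

/-! ## The one printed input of `p`-adic Hodge theory -/

/-- **de Rham ⇒ Hodge–Tate (Fontaine), over the tree's carriers.**  For `ρ : Γ_K → GL_n(ℚ̄_ℓ)` and
`v ∣ ℓ`: if `ρ|_{Γ_{K_v}}` is de Rham for Fontaine's pinned datum `fontainePstAdicCompletion v ℓ hv`
(the term `RD.pst ℓ v hv` of the summit, for every `RD`), then `ρ|_{Γ_{K_v}}` is Hodge–Tate at every
`τ : K_v →+* ℚ̄_ℓ` for the canonical `ℚ_ℓ`-structure (Sen's `Θ_τ` is semisimple with integer
eigenvalues).  PRINTED: `B_dR`-admissible ⇒ `B_HT`-admissible (`gr B_dR = B_HT`), and a Hodge–Tate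
`W = ℂ ⊗ V` has `Θ` semisimple with eigenvalues the Hodge–Tate weights (Brinon–Conrad, Ex. 15.5.4; Berger 2004 §2; Fontaine 1994
Exp. III §1.5, §3).  A named HYPOTHESIS here (the two pinned-by-specification carriers are not yet
linked in the tree); stated under `SenOperatorExistsUnique`, which gives the pinned `Θ` its meaning. -/
def DeRhamIsHodgeTate : Prop :=
  SenOperatorExistsUnique →
  ∀ (K : Type) [Field K] [NumberField K] (ℓ : ℕ) [Fact ℓ.Prime] (n : ℕ)
    (ρ : FramedGaloisRep K (PadicAlgCl ℓ) n) (v : HeightOneSpectrum (𝓞 K))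
    (hv : ((ℓ : ℕ) : 𝓞 K) ∈ v.asIdeal),
    (Literature.NumberTheory.PAdicHodge.fontainePstAdicCompletion v ℓ hv).IsDeRhamFramed
        (ρ.toLocal v) →
      ∀ τ : v.adicCompletion K →+* PadicAlgCl ℓ,
        ρ.IsHodgeTateAt v (LocalField.adicCompletionPadicAlgebra v ℓ hv) τ

/-! ## The open heart of the crux is a consequence of the summit -/

/-- **`S` ⇒ the open heart.**  Under the summit `Langlands` and Fontaine's `DeRhamIsHodgeTate`,
every `ρ` as in the crux (irreducible, Satake–Frobenius compatible a.e. with an L-algebraic cuspidal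
`π` on `GL₂/K`) is Hodge–Tate at every `τ` above EVERY `v ∣ ℓ` — in particular at the aligned ones
(the statement of the registered stub `stub_hodgeTateAtAligned`, minus its `SenOperatorExistsUnique`
antecedent).  Proof: `RD` from the non-vacuity conjunct; `ρ_π` from (A) at `n = 2`; `ρ_π ~ ρ` by
the landed Chebotarev + Brauer–Nesbitt theorem; geometricity transports along conjugacy (landed);
`RD.pst ℓ v hv` IS Fontaine's pinned datum (definitional). [folklore] -/
theorem hodgeTateAtPlace_of_langlands (hS : _root_.Langlands) (hF : DeRhamIsHodgeTate)
    (hSen : SenOperatorExistsUnique) :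
    UnderCruxHypotheses fun _ _ _ _ _ ρ v hv => HodgeTateAtPlace ρ v hv := by
  intro K _ _ _hK hcpt π _k _w hL _hhol _hodd _hne ℓ _ ι ρ _hirr hae v hv _hal
  obtain ⟨⟨RD⟩, hall⟩ := hS K
  obtain ⟨hA, -⟩ := hall RD 2 two_pos hcpt
  obtain ⟨ρπ, hirrπ, hgeoπ, hcorrπ, -⟩ := hA π hL ℓ ι
  have hconj : IsConjugate ρπ ρ :=
    isConjugate_of_satakeFrobCompatibleAt π.1 ι hirrπ hcorrπ.1 hae
  have hgeo : IsGeometricFramed RD ρ := isGeometricFramed_of_isConjugate hgeoπ hconj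
  intro τ
  exact hF hSen K ℓ 2 ρ v hv (hgeo.2 v hv) τ

/-! ## The two printed stubs of line `birth` (statements verbatim) and the consequence -/

/-- Statement of `Birth.stub_senWeightsCoincideAtAligned` (Boxer–Pilloni 2021 Thm. 23 (3): the
generalized `ι⁻¹∘τ`-Hodge–Tate weights of `ρ_{π,ι}` collapse to one integer at a weight-one `τ`;
in print, conditional on `SenOperatorExistsUnique` for the meaning of the pinned `Θ`). -/
def S1_SenWeightsCoincideAtAligned : Prop :=
  SenOperatorExistsUnique → UnderCruxHypotheses fun _ _ _ _ _ ρ v hv => SenSingleWeightAt ρ v hv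

/-- Statement of `Birth.stub_projectiveSenFiniteness` (Sen 1973 in projective form + the
local/global inertia dictionary; provable now from the two Sen facts, size M). -/
def S3_ProjectiveSenFiniteness : Prop :=
  SenOperatorExistsUnique → SenFiniteness →
    ∀ (K : Type) [Field K] [NumberField K] (ℓ : ℕ) [Fact ℓ.Prime]
      (ρ : FramedGaloisRep K (PadicAlgCl ℓ) 2) (v : HeightOneSpectrum (𝓞 K))
      (hv : ((ℓ : ℕ) : 𝓞 K) ∈ v.asIdeal),
      SenSingleWeightAt ρ v hv → HodgeTateAtPlace ρ v hv → ProjFiniteInertiaAt ρ v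

/-- **`S` + printed theorems ⇒ `C`.**  The crux `SingularProjectiveFinite` (by NAME) follows from the
summit `Langlands` together with: Fontaine's de Rham ⇒ Hodge–Tate, Sen's two theorems (the tree's
named facts), Boxer–Pilloni's Sen-weight computation at aligned places (`S1`) and projective Sen
finiteness (`S3`).  Every antecedent other than `Langlands` is a theorem in print; hence the crux is
a CONSEQUENCE of the summit (strictly weaker on paper, since `C → S` has no proof: probes
`bc/SPF_probe_CtoS*.lean`). [folklore] -/
theorem singularProjectiveFinite_of_langlands (hS : _root_.Langlands) (hF : DeRhamIsHodgeTate)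
    (hSen : SenOperatorExistsUnique) (hFin : SenFiniteness)
    (h₁ : S1_SenWeightsCoincideAtAligned) (h₃ : S3_ProjectiveSenFiniteness) :
    SingularProjectiveFinite := by
  intro K _ _ hK hcpt π k w hL hhol hodd hne ℓ _ ι ρ hirr hae v hv hal
  exact h₃ hSen hFin K ℓ ρ v hv
    (h₁ hSen K hK hcpt π k w hL hhol hodd hne ℓ ι ρ hirr hae v hv hal)
    (hodgeTateAtPlace_of_langlands hS hF hSen K hK hcpt π k w hL hhol hodd hne ℓ ι ρ hirr hae v hv hal)

/-- The same, phrased against the registered skeleton: the summit DISCHARGES the open stub.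
`Langlands → DeRhamIsHodgeTate → (SenOperatorExistsUnique → UnderCruxHypotheses HodgeTateAtPlace)`,
i.e. the statement `_Goal.stub_hodgeTateAtAligned` of `Lines/birth.lean`, verbatim. [folklore] -/
theorem stub_hodgeTateAtAligned_of_langlands (hS : _root_.Langlands) (hF : DeRhamIsHodgeTate) :
    SenOperatorExistsUnique →
      UnderCruxHypotheses fun _ _ _ _ _ ρ v hv => HodgeTateAtPlace ρ v hv :=
  fun hSen => hodgeTateAtPlace_of_langlands hS hF hSen

end Summit.Langlands.Langlands.Cruxes.SingularProjectiveFinite.PositionR1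

end
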